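import Summits.BirchSwinnertonDyer.BirchSwinnertonDyer.Theorems.GenusKolyvaginAtTwoGenusPrimitiveSupplyAtTwoExactnessCriterion
import Summits.BirchSwinnertonDyer.BirchSwinnertonDyer.Theorems.GenusKolyvaginAtTwoGenusPrimitiveSupplyAtTwoGenusReductionComposite
import Summits.BirchSwinnertonDyer.Rank1Residual.X11b.RingClassTowerRestriction
import Literature.NumberTheory.EllipticCurves.HeegnerPointsOfConductorOneData

/-!
# Route `GenusKolyvaginAtTwo`, crux `GenusPrimitiveSupplyAtTwo` (stmt-BirchSwinnertonDyer-22136), line `genus-supply`: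
# TOWER GLUE `K[1] ⊆ K[n]` — `y_K = P(1)` read in `E(K[n])` IS `y_K′ = Σ_{s∈S} s·y₁`; the prime-level exactness criterion
# IN THE CRUX'S OWN FRAME (McCallum's `M₀` through the conductor-`1` datum `d₁`)

Lead prover seat bsd-line-gk2-p1 (g3). The crux quantifies `M₀` through a conductor-`1` datum `d₁` (`2^{M₀} ∥ d₁.derivedPoint` in
`E(K[1])`), while the dictionary of line `genus-supply` reads `y_K` inside `E(K[ℓ])` as `y_K′ := Σ_{s ∈ S} s·y₁` (`S` the level-`ℓ`
datum's transversal of `G_ℓ` in `𝒢_ℓ`, `y₁ ∈ E(K[ℓ])` the point over `x(1)`). This file identifies the two along the ring class tower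
(x11b3's `RingClassTower.exists_restrictHom`: `res : 𝒢_n → 𝒢_1` with the value formula; kernel `G_n`; onto), using the
abstract-subfield device of `HeegnerPointsOfConductorOneData` (the kernel never compares two concrete ring class fields):
* §1 (abstract subfields `S ≤ T ⊆ L`) automorphisms of `T` fixing `T ∩ S` fix the points over `S`; `g·P′ = (res g·P)′`;
* §2 `res` is a bijection from the transversal `d.S` onto `𝒢_1`; with `mem_S_iff` (`d₁.S = 𝒢_1`):
  **`(d₁.derivedPoint)′ = Σ_{s ∈ d.S} s·(d₁.y)′`** in `E(K[n])`, hence `2 ∣ d₁.derivedPoint` in `E(K[1])` ⟹ `2 ∣ y_K′` in `E(K[n])`;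
* §3 the PRIME-LEVEL EXACTNESS CRITERION IN THE CRUX'S FRAME: `ℓ` a Kolyvagin prime at `2`, `2 ∣ d₁.derivedPoint` (McCallum
  `M₀ ≥ 1`): `P(ℓ) ∈ 2E(K[ℓ]) ⟺ Y_χ ∈ 4E(K[ℓ])`; and the DICHOTOMY for the crux's certificate clause at prime level: either
  `P(1) = y_K ∉ 2E(K[1])` (the crux's clause holds with `n = 1`), or «`P(ℓ) ∉ 2E(K[ℓ]) ⟺ Y_{χ_ℓ} ∉ 4E(K[ℓ])`» at every Kolyvagin prime.
Helper (`--supports stmt-BirchSwinnertonDyer-22136`); the crux stays OPEN; BSD is not proved by any of this.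
-/

set_option linter.dupNamespace false -- tree convention: `Summit.BirchSwinnertonDyer.BirchSwinnertonDyer.Theorems` (summit = sub-problem)

noncomputable section

open scoped Classical

namespace Summit.BirchSwinnertonDyer.BirchSwinnertonDyer.Theorems.GenusKoly

open Finset NumberField WeierstrassCurve Literature.NumberTheory.EllipticCurves
  Literature.NumberTheory.EllipticCurves.ModularForms Summit.BirchSwinnertonDyer.Rank1Residual.X11b

/-! ## §1 Abstract subfields `S ≤ T` of a field `L`: points over `S` read in `E(T)` -/

section Abstract

variable {W : WeierstrassCurve ℚ} {L : Type*} [Field L] [CharZero L] {S T : Subfield L}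

/-- An automorphism of `T` fixing the elements of `T` lying in `S` fixes the image of `S`. [folklore] -/
theorem apply_inclusion_of_mem_fixingSubgroup (hle : S ≤ T) {k : T ≃ₐ[ℚ] T}
    (hk : k ∈ fixingSubgroup (T ≃ₐ[ℚ] T) {z : T | (z : L) ∈ S}) (x : S) :
    k (Subfield.inclusion hle x) = Subfield.inclusion hle x :=
  (_root_.mem_fixingSubgroup_iff (M := T ≃ₐ[ℚ] T)).mp hk _ x.2

/-- **Automorphisms of `T` over `S` fix the points over `S`** read in `E(T)`. [folklore] -/
theorem pointGalHom_map_inclusion_of_mem_fixingSubgroup (hle : S ≤ T) {k : T ≃ₐ[ℚ] T}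
    (hk : k ∈ fixingSubgroup (T ≃ₐ[ℚ] T) {z : T | (z : L) ∈ S}) (P : (W.baseChange S).toAffine.Point) :
    pointGalHom W T k (WeierstrassCurve.Affine.Point.map (W' := W) (Subfield.inclusion hle).toRatAlgHom P) =
      WeierstrassCurve.Affine.Point.map (W' := W) (Subfield.inclusion hle).toRatAlgHom P := by
  rcases P with _ | ⟨x, y, hxy⟩
  · rfl
  · rw [pointGalHom_apply, Affine.Point.map_some, Affine.Point.map_some]
    simp only [Affine.Point.some.injEq, AlgEquiv.coe_toAlgHom]
    exact ⟨apply_inclusion_of_mem_fixingSubgroup hle hk x, apply_inclusion_of_mem_fixingSubgroup hle hk y⟩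

/-- The value formula of a «restriction» `res`, on elements: `g(x′) = (res g x)′`. [folklore] -/
theorem apply_inclusion_eq_inclusion_of_valueFormula (hle : S ≤ T) {G : Subgroup (T ≃ₐ[ℚ] T)}
    {res : G →* (S ≃ₐ[ℚ] S)}
    (hres : ∀ (g : G) (x : S) (y : T), (x : L) = (y : L) → ((res g x : S) : L) = (((g : T ≃ₐ[ℚ] T) y : T) : L))
    (g : G) (x : S) : (g : T ≃ₐ[ℚ] T) (Subfield.inclusion hle x) = Subfield.inclusion hle (res g x) :=
  Subtype.ext (hres g x (Subfield.inclusion hle x) rfl).symm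

/-- **`g·P′ = (res g·P)′`**: an automorphism acts on a point over `S` read in `E(T)` through its restriction. [folklore] -/
theorem pointGalHom_map_inclusion_eq_of_valueFormula (hle : S ≤ T) {G : Subgroup (T ≃ₐ[ℚ] T)}
    {res : G →* (S ≃ₐ[ℚ] S)}
    (hres : ∀ (g : G) (x : S) (y : T), (x : L) = (y : L) → ((res g x : S) : L) = (((g : T ≃ₐ[ℚ] T) y : T) : L))
    (g : G) (P : (W.baseChange S).toAffine.Point) :
    pointGalHom W T (g : T ≃ₐ[ℚ] T) (WeierstrassCurve.Affine.Point.map (W' := W) (Subfield.inclusion hle).toRatAlgHom P) =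
      WeierstrassCurve.Affine.Point.map (W' := W) (Subfield.inclusion hle).toRatAlgHom (pointGalHom W S (res g) P) := by
  rcases P with _ | ⟨x, y, hxy⟩
  · rfl
  · rw [pointGalHom_apply, pointGalHom_apply, Affine.Point.map_some, Affine.Point.map_some, Affine.Point.map_some,
      Affine.Point.map_some]
    simp only [Affine.Point.some.injEq, AlgEquiv.coe_toAlgHom]
    exact ⟨apply_inclusion_eq_inclusion_of_valueFormula hle hres g x,
      apply_inclusion_eq_inclusion_of_valueFormula hle hres g y⟩

end Abstract

/-! ## §2 The Heegner frame: `(d₁.derivedPoint)′ = Σ_{s ∈ d.S} s·(d₁.y)′` in `E(K[n])` -/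

section Heegner

variable {W : WeierstrassCurve ℚ} [NeZero (W.conductorNorm ℤ)] {K : Type} [Field K] [NumberField K]
  {Dt : ModularParametrizationData W (W.conductorNorm ℤ)} {β : ℤ} {ι : K →+* ℂ}

/-- **`res` restricted to the transversal `S` is a bijection onto `𝒢_1`, read on sums**: for a datum `d` of conductor `n ≠ 0`
(transversal `d.S` of `G_n = ker(res)` in `𝒢_n`), a datum `d₁` of conductor `1` (`d₁.S = 𝒢_1`, `mem_S_iff`) and any restriction
homomorphism `res : 𝒢_n → Aut(K[1])` with the value formula:
`Σ_{s ∈ d.S} f(res s) = Σ_{t ∈ d₁.S} f(t)`. [cite: GrossLMS1991, §4 (4.1) and the exact sequence `0 → G_n → 𝒢_n → Gal(K_1/K) → 0`] -/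
theorem heegner_sum_transversal_restrict_eq_sum (hK : IsImaginaryQuadratic K) {n : ℕ} (hn : n ≠ 0)
    (d : KolyvaginHeegnerData Dt β ι n) (d₁ : KolyvaginHeegnerData Dt β ι 1)
    {res : ringClassGal ι n →* (ringClassField K ι 1 ≃ₐ[ℚ] ringClassField K ι 1)}
    (hres : ∀ (g : ringClassGal ι n) (x : ringClassField K ι 1) (y : ringClassField K ι n), (x : ℂ) = (y : ℂ) →
      ((res g x : ringClassField K ι 1) : ℂ) = (((g : ringClassField K ι n ≃ₐ[ℚ] ringClassField K ι n) y : ringClassField K ι n) : ℂ))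
    {A : Type*} [AddCommMonoid A] (f : (ringClassField K ι 1 ≃ₐ[ℚ] ringClassField K ι 1) → A) :
    ∑ s ∈ d.S, f (if hs : s ∈ ringClassGal ι n then res ⟨s, hs⟩ else 1) = ∑ t ∈ d₁.S, f t := by
  have h11 : ringClassField K ι 1 ≤ ringClassField K ι 1 := le_rfl
  refine Finset.sum_nbij (fun s ↦ if hs : s ∈ ringClassGal ι n then res ⟨s, hs⟩ else 1) (fun s hs ↦ ?_)
    (fun s hs s' hs' h ↦ ?_) (fun t ht ↦ ?_) (fun _ _ ↦ rfl)
  · -- into `d₁.S = 𝒢_1`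
    rw [dif_pos (d.S_subset s hs), d₁.mem_S_iff]
    exact RingClassTower.restrictHom_mem_ringClassGal ι hres _
  · -- injective on `S`: equal restrictions differ by an element of `G_n = ker res`
    have hs𝒢 := d.S_subset s hs
    have hs'𝒢 := d.S_subset s' hs'
    simp only [dif_pos hs𝒢, dif_pos hs'𝒢] at h
    have hker : res (⟨s, hs𝒢⟩⁻¹ * ⟨s', hs'𝒢⟩) = 1 := by rw [map_mul, map_inv, h, inv_mul_cancel]
    have hmem : s⁻¹ * s' ∈ ringClassGalOver ι n 1 := by
      have := RingClassTower.mem_ringClassGalOver_of_restrictHom_mem ι hres h11 (⟨s, hs𝒢⟩⁻¹ * ⟨s', hs'𝒢⟩)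
        (by rw [hker]; exact one_mem _)
      simpa using this
    obtain ⟨t, -, huniq⟩ := d.S_transversal s hs𝒢
    have h1 : s = t := huniq s ⟨hs, by rw [inv_mul_cancel]; exact one_mem _⟩
    have h2 : s' = t := huniq s' ⟨hs', hmem⟩
    rw [h1, h2]
  · -- onto `d₁.S`: lift `t ∈ 𝒢_1` to `𝒢_n`, then move to the transversal inside the coset of `G_n`
    have ht𝒢 : t ∈ ringClassGal ι 1 := d₁.S_subset t ht
    obtain ⟨g, hg⟩ := RingClassTower.exists_restrictHom_eq hK ι (one_dvd n) hn hres ht𝒢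
    obtain ⟨s, ⟨hsS, hs⟩, -⟩ := d.S_transversal (g : ringClassField K ι n ≃ₐ[ℚ] ringClassField K ι n) g.2
    refine ⟨s, Finset.mem_coe.mpr hsS, ?_⟩
    have hs𝒢 := d.S_subset s hsS
    simp only [dif_pos hs𝒢]
    have hprod : (⟨s, hs𝒢⟩ : ringClassGal ι n) = g * ⟨(g : ringClassField K ι n ≃ₐ[ℚ] ringClassField K ι n)⁻¹ * s,
        ringClassGalOver_le_ringClassGal ι n 1 hs⟩ := Subtype.ext (by simp)
    rw [hprod, map_mul, RingClassTower.restrictHom_eq_one_of_mem hK ι (one_dvd n) hn hres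
      ⟨(g : ringClassField K ι n ≃ₐ[ℚ] ringClassField K ι n)⁻¹ * s, ringClassGalOver_le_ringClassGal ι n 1 hs⟩ hs, mul_one, hg]

/-- **`(d₁.derivedPoint)′ = Σ_{s ∈ d.S} s·(d₁.y)′` in `E(K[n])`**: the conductor-`1` derived point `P(1) = Tr_{K[1]/K} y(1) = y_K`
read in `E(K[n])` along `K[1] ⊆ K[n]` is the line's `y_K′` (`S` the level-`n` transversal). (`s·(d₁.y)′ = (res s·d₁.y)′`, `res|_S`
bijective onto `𝒢_1 = d₁.S`, `P(1) = Σ_{t ∈ d₁.S} t·y(1)`.) [cite: GrossLMS1991, §4 (4.1), P_1 = y_K] -/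
theorem heegner_map_derivedPoint_one_eq_sum (hK : IsImaginaryQuadratic K) {n : ℕ} (hn : n ≠ 0)
    (d : KolyvaginHeegnerData Dt β ι n) (d₁ : KolyvaginHeegnerData Dt β ι 1)
    (hle : ringClassField K ι 1 ≤ ringClassField K ι n) :
    WeierstrassCurve.Affine.Point.map (W' := W) (Subfield.inclusion hle).toRatAlgHom d₁.derivedPoint =
      ∑ s ∈ d.S, pointGalHom W (ringClassField K ι n) s
        (WeierstrassCurve.Affine.Point.map (W' := W) (Subfield.inclusion hle).toRatAlgHom d₁.y) := by
  obtain ⟨res, hres⟩ := RingClassTower.exists_restrictHom hK ι (one_dvd n) hn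
  have key : ∀ s ∈ d.S, pointGalHom W (ringClassField K ι n) s
      (WeierstrassCurve.Affine.Point.map (W' := W) (Subfield.inclusion hle).toRatAlgHom d₁.y) =
      WeierstrassCurve.Affine.Point.map (W' := W) (Subfield.inclusion hle).toRatAlgHom
        (pointGalHom W (ringClassField K ι 1) (if hs : s ∈ ringClassGal ι n then res ⟨s, hs⟩ else 1) d₁.y) := by
    intro s hs
    rw [dif_pos (d.S_subset s hs)]
    exact pointGalHom_map_inclusion_eq_of_valueFormula hle hres ⟨s, d.S_subset s hs⟩ d₁.y
  rw [Finset.sum_congr rfl key, ← map_sum,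
    heegner_sum_transversal_restrict_eq_sum hK hn d d₁ hres (fun t ↦ pointGalHom W (ringClassField K ι 1) t d₁.y),
    ← d₁.derivedPoint_one]

/-- **`M₀ ≥ 1 ⟹ y_K′ ∈ 2E(K[n])`**: if the conductor-`1` derived point is `2`-divisible in `E(K[1])` (McCallum `M₀ ≥ 1`, the crux's
`∃ Q, 2^{M₀} Q = d₁.derivedPoint` with `M₀ ≥ 1`), then for the point `y₁ ∈ E(K[n])` over `x(1)` the line's `y_K′ = Σ_{s∈S} s·y₁` is
`2`-divisible in `E(K[n])`. [cite: GrossLMS1991, §4 (4.1)] [cite: McCallumLMS1991, §5 (M₀)] -/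
theorem heegner_exists_two_zsmul_eq_trace_of_two_dvd_derivedPoint_one [W.IsElliptic] (hK : IsImaginaryQuadratic K) {n : ℕ}
    (hn : n ≠ 0) (d : KolyvaginHeegnerData Dt β ι n) (d₁ : KolyvaginHeegnerData Dt β ι 1)
    (h2 : ∃ Q₁ : (W.baseChange (ringClassField K ι 1)).toAffine.Point, (2 : ℤ) • Q₁ = d₁.derivedPoint)
    {y₁ : (W.baseChange (ringClassField K ι n)).toAffine.Point}
    (hy₁ : WeierstrassCurve.Affine.Point.map (W' := W) (ringClassField K ι n).subtype.toRatAlgHom y₁ =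
      heegnerPointComplexOfConductor Dt (NumberField.discr K) β 1) :
    ∃ Q : (W.baseChange (ringClassField K ι n)).toAffine.Point, (2 : ℤ) • Q =
      ∑ s ∈ d.S, pointGalHom W (ringClassField K ι n) s y₁ := by
  have hle : ringClassField K ι 1 ≤ ringClassField K ι n := ringClassField_mono hK ι (one_dvd n) hn
  obtain ⟨Q₁, hQ₁⟩ := h2
  have hy : WeierstrassCurve.Affine.Point.map (W' := W) (Subfield.inclusion hle).toRatAlgHom d₁.y = y₁ :=
    heegner_eq_of_map_eq hy₁ ((map_subtype_map_inclusion_eq hle W d₁.y).trans d₁.map_y)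
  refine ⟨WeierstrassCurve.Affine.Point.map (W' := W) (Subfield.inclusion hle).toRatAlgHom Q₁, ?_⟩
  rw [← map_zsmul, hQ₁, heegner_map_derivedPoint_one_eq_sum hK hn d d₁ hle, hy]

/-! ## §3 The prime-level exactness criterion in the crux's frame, and the dichotomy -/

/-- **PRIME-LEVEL EXACTNESS CRITERION IN THE CRUX'S FRAME.** For `W` globally minimal with `ρ̄_{E,2}` onto, `K` imaginary quadratic
with odd `d_K ≠ −3` and the Heegner hypothesis, a Kolyvagin prime `ℓ` at `2` (inert, `ℓ ∤ N_E`, `2 ∣ a_ℓ`), data `d₁` (conductor `1`)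
and `d` (conductor `ℓ`), `θ = √ℓ*`-data `(θ, T⁺, T⁻)` as in `…GenusCharacter`, and McCallum's `M₀ ≥ 1` in the crux's own currency
(`2 ∣ d₁.derivedPoint` in `E(K[1])`): `P(ℓ) ∈ 2E(K[ℓ]) ⟺ Y_χ ∈ 4E(K[ℓ])`. [cite: GrossLMS1991, §3 (3.5), Prop. 3.7 (1), §4 (4.1), Lemma 4.3]
[cite: McCallumLMS1991, §5] -/
theorem heegner_exists_two_zsmul_eq_derivedPoint_iff_four_dvd_genusCharacterPoint_of_levelOne [W.IsElliptic] [W.IsGloballyMinimal]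
    (hK : IsImaginaryQuadratic K) (hodd : Odd (NumberField.discr K)) (h3 : NumberField.discr K ≠ -3)
    (hH : SatisfiesHeegnerHypothesis (W.conductorNorm ℤ) K) (hsurj : W.HasSurjectiveModNGaloisRep ((2 : ℤ) ^ 1))
    {ℓ : ℕ} (hℓ : ℓ.Prime) (hinert : (Ideal.span {(ℓ : 𝓞 K)}).IsPrime) (hℓN : ¬ ℓ ∣ W.conductorNorm ℤ)
    (ha : (2 : ℤ) ∣ W.frobeniusTrace ℓ) (d₁ : KolyvaginHeegnerData Dt β ι 1) (d : KolyvaginHeegnerData Dt β ι ℓ)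
    {θ : ringClassField K ι ℓ} {q : ℚ} (hθ2 : θ ^ 2 = algebraMap ℚ (ringClassField K ι ℓ) q) (hθ0 : θ ≠ 0)
    (hflip : ∃ τ ∈ ringClassGalOver ι ℓ 1, τ θ = -θ)
    (Tp Tm : Finset (ringClassField K ι ℓ ≃ₐ[ℚ] ringClassField K ι ℓ))
    (hTp : ∀ g, g ∈ Tp ↔ g ∈ ringClassGal ι ℓ ∧ g θ = θ) (hTm : ∀ g, g ∈ Tm ↔ g ∈ ringClassGal ι ℓ ∧ g θ = -θ)
    (hM : ∃ Q₁ : (W.baseChange (ringClassField K ι 1)).toAffine.Point, (2 : ℤ) • Q₁ = d₁.derivedPoint) :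
    (∃ Q : (W.baseChange (ringClassField K ι ℓ)).toAffine.Point, (2 : ℤ) • Q = d.derivedPoint) ↔
      ∃ R : (W.baseChange (ringClassField K ι ℓ)).toAffine.Point, (4 : ℤ) • R =
        ∑ g ∈ Tp, pointGalHom W (ringClassField K ι ℓ) g d.y - ∑ g ∈ Tm, pointGalHom W (ringClassField K ι ℓ) g d.y := by
  obtain ⟨y₁, hy₁⟩ := heegner_exists_map_eq_heegnerPointComplexOfConductor_one hK hℓ.ne_zero d
  exact heegner_exists_two_zsmul_eq_derivedPoint_iff_genusCharacterPoint_four_dvd hK hodd (discr_lt_neg_four_of_odd hK hodd h3)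
    hH hsurj hℓ hinert hℓN ha d hθ2 hθ0 hflip Tp Tm hTp hTm hy₁
    (heegner_exists_two_zsmul_eq_trace_of_two_dvd_derivedPoint_one hK hℓ.ne_zero d d₁ hM hy₁)

/-- **DICHOTOMY for the crux's certificate clause at prime level.** Same frame, NO hypothesis on `M₀`: either the conductor-`1` point
`P(1) = y_K` is already `2`-primitive in `E(K[1])` — the crux's clause «`∃ n d, … P(n) ∉ 2E(K[n])`» then holds with `n = 1`
(`…GenusReductionComposite.exists_derivedPoint_not_two_dvd_of_level_one`) —, or `M₀ ≥ 1` and the Kolyvagin prime `ℓ` certifies EXACTLY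
when its genus-character Heegner point `Y_{χ_ℓ}` is not `4`-divisible (it is always `2`-divisible, `…ExactnessCriterion` §1).
[cite: GrossLMS1991, §3 (3.5), §4 (4.1)] [cite: McCallumLMS1991, §5] -/
theorem heegner_levelOne_or_prime_certificate_iff [W.IsElliptic] [W.IsGloballyMinimal]
    (hK : IsImaginaryQuadratic K) (hodd : Odd (NumberField.discr K)) (h3 : NumberField.discr K ≠ -3)
    (hH : SatisfiesHeegnerHypothesis (W.conductorNorm ℤ) K) (hsurj : W.HasSurjectiveModNGaloisRep ((2 : ℤ) ^ 1))
    {ℓ : ℕ} (hℓ : ℓ.Prime) (hinert : (Ideal.span {(ℓ : 𝓞 K)}).IsPrime) (hℓN : ¬ ℓ ∣ W.conductorNorm ℤ)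
    (ha : (2 : ℤ) ∣ W.frobeniusTrace ℓ) (d₁ : KolyvaginHeegnerData Dt β ι 1) (d : KolyvaginHeegnerData Dt β ι ℓ)
    {θ : ringClassField K ι ℓ} {q : ℚ} (hθ2 : θ ^ 2 = algebraMap ℚ (ringClassField K ι ℓ) q) (hθ0 : θ ≠ 0)
    (hflip : ∃ τ ∈ ringClassGalOver ι ℓ 1, τ θ = -θ)
    (Tp Tm : Finset (ringClassField K ι ℓ ≃ₐ[ℚ] ringClassField K ι ℓ))
    (hTp : ∀ g, g ∈ Tp ↔ g ∈ ringClassGal ι ℓ ∧ g θ = θ) (hTm : ∀ g, g ∈ Tm ↔ g ∈ ringClassGal ι ℓ ∧ g θ = -θ) :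
    (¬ ∃ Q₁ : (W.baseChange (ringClassField K ι 1)).toAffine.Point, (2 : ℤ) • Q₁ = d₁.derivedPoint) ∨
      ((¬ ∃ Q : (W.baseChange (ringClassField K ι ℓ)).toAffine.Point, (2 : ℤ) • Q = d.derivedPoint) ↔
        ¬ ∃ R : (W.baseChange (ringClassField K ι ℓ)).toAffine.Point, (4 : ℤ) • R =
          ∑ g ∈ Tp, pointGalHom W (ringClassField K ι ℓ) g d.y - ∑ g ∈ Tm, pointGalHom W (ringClassField K ι ℓ) g d.y) := by
  by_cases hM : ∃ Q₁ : (W.baseChange (ringClassField K ι 1)).toAffine.Point, (2 : ℤ) • Q₁ = d₁.derivedPoint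
  · exact Or.inr (not_congr (heegner_exists_two_zsmul_eq_derivedPoint_iff_four_dvd_genusCharacterPoint_of_levelOne hK hodd h3
      hH hsurj hℓ hinert hℓN ha d₁ d hθ2 hθ0 hflip Tp Tm hTp hTm hM))
  · exact Or.inl hM

end Heegner

end Summit.BirchSwinnertonDyer.BirchSwinnertonDyer.Theorems.GenusKoly

end
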